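import Summits.ABC.IUTFork.Joshi.LogLinkFrobeniusTransport
import Mathlib.NumberTheory.Padics.Complex
import HarnessLib

/-!
# A `μ_∞`-INVARIANT, norm-preserving SURJECTION `Λ : Q̄_p → Q̄_p` (supply for the W6 datum), and why §10.13's transports together
# with the Witt–Teichmüller law `ϕ([a]) = [a^p]` FORCE such a map over the [J-IIp] period-ring signature

Supply file of the abc-iut cell, block E «type Joshi's construction, test vs S» (rung LADDER-ABC:A2.E; seat abc-iut-E-t52 gen 4 — the
`TeichFrobModel` lineage p434703 / p439129 / p445632), written for the W6 entry of the block's VACUITY column (E-t50 g5, STATUS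
2026-08-26T13:07:13Z / 13:31:38Z «IMPORT Λ»; boundary theorem `Joshi/LogLinkTransportPeriodicPoints.lean` p447117): a datum of E-t3's
signature `PeriodRingDatum` (`Joshi/ThetaValuesLocus.lean`, p427971) carrying E-t2's `EtaPtTeich`, a bijective point-Frobenius, E-t7's
§10.13 `FrobeniusTransport` (p430819) at EVERY classical point, and the Witt law `ϕ([a]) = [a^p]` — the print-shaped package of
K. Joshi, arXiv:2303.01662v3 §6.6 / §10.13 (`paper:arxiv-2303.01662`, bib `Joshi2023ATS2Local`, UNREFEREED — typed AS A CANDIDATE by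
E-t3/E-t7/E-t2; nothing of it is asserted here). E-t50 g5 builds that datum (`Joshi/PrototypeWittModel.lean`) against an abstract
«invariant lift»; THIS file supplies the lift and records, over the signature, why it is needed. TAKES NO SIDE on [IUTchIII] Cor. 3.12,
on Joshi's claims, or on Mochizuki's reports on them; typed ≠ proved; a supply lemma exhibits an object, nothing more.

WHAT IS PROVED.
* §1 (signature level, every datum `D`, all inputs BINDERS) **`PeriodRingDatum.eta_teich_mul_eq_of_transports`**: if `ϕ([a]) = [a^p]`
  for all `a` and the forward `ϕ`-orbit `y, ϕy, ϕ²y, …` of a point carries §10.13 transports, then `η_y([ζ·x]) = η_y([x])` for every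
  `ζ ∈ μ_{p^∞}(F)` — `ϕ^k([ζx] − [x]) = [ζ^{p^k}x^{p^k}] − [x^{p^k}] = 0` and `ker(η_{ϕ^k y} ∘ ϕ^k) = ker η_y` (E-t7's `residueIso`, injective,
  `k` times). With (A1) `|η_y([x])|_{K_y} = |x|_F` and (A2) (lifts of the unit ball) the map `Λ_y := η_y ∘ [·] : F → K_y` is therefore
  `μ_{p^∞}(F)`-invariant, norm-compatible and onto the unit ball (`exists_invariant_lift_of_transports`). Over the cell's carriers
  `F = K_y = Q̄_p` (characteristic `0`, `μ_{p^∞}` infinite) any W6 datum must contain such a map; in print (`F` of characteristic `p`,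
  `μ_{p^∞}(F) = 1`) the condition is void — a boundary of the chosen carriers, located, not a defect of any file.
* §2 (supply over `Q̄_p = PadicAlgCl p`) the TORSION relation `a ≈ b :⟺ ∃ k ≠ 0, a^k = b^k` (classes `a·μ_∞`; coarser than
  `μ_{p^∞}`, as E-t50 asked, so that a value of `Λ` is repeated on `≥ 2` `μ_{p^∞}`-classes of each sphere), its quotient `TorsionQuot`
  with the descended norm `tnorm`, and **`invLift : Q̄_p → Q̄_p`** with `invLift_eq_of_pow_eq` (`a^k = b^k`, `k ≠ 0` ⟹ `Λ a = Λ b`),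
  `norm_invLift` (`‖Λ x‖ = ‖x‖`) and `invLift_surjective`. CONSTRUCTION (no `p`-adic logarithm; `PadicAlgCl p` is not complete): on each
  sphere `S_r` the quotient map `S_r → S_r/≈` has COUNTABLE fibres (`x^k = x₀^k` has finitely many solutions for each `k`) and an
  INFINITE target (`x₀·(1+p)^n`, `n ∈ ℕ`, are pairwise inequivalent: `1+p` is a norm-one unit of infinite order), so
  `#S_r ≤ #(S_r/≈)·ℵ₀ = #(S_r/≈)` (`Cardinal.mk_le_mk_mul_of_mk_preimage_le`, `Cardinal.mul_aleph0_eq`); glue the resulting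
  norm-preserving injection `normEmb : Q̄_p ↪ TorsionQuot` and invert it on its image (`invLiftT`), representatives elsewhere.
  Packaged: `exists_invariantLift`.
[folklore] throughout (set theory and valuation bookkeeping); no claim about Joshi's or Mochizuki's mathematics is made or implied.
-/

noncomputable section

open Cardinal

namespace Summit.ABC.IUTFork.Joshi

/-! ## 1. Over the signature: transports + the Witt law make `η_y ∘ [·]` invariant under `μ_{p^∞}(F)` -/

namespace PeriodRingDatum

variable {F B E0 : Type} [Field F] [CommRing B] [Field E0] {Y : Type} {K : Y → Type} [∀ y, Field (K y)] {G : Type}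
  (D : PeriodRingDatum F B E0 Y K G)

/-- **Necessity.** Under the Witt–Teichmüller law `hφ : ϕ([a]) = [a^p]` (print §10.13 p.33 l.7–10, a BINDER) and §10.13 transports
(E-t7's `FrobeniusTransport`, BINDERS) at every point of the forward orbit `y, ϕy, ϕ²y, …`: `η_y([ζ·x]) = η_y([x])` whenever
`ζ^{p^k} = 1`. Proof: induction on `k`; `σ_y (η_y [ζx]) = η_{ϕy}(ϕ[ζx]) = η_{ϕy}([ζ^p x^p])` (`residueIso_eta`, `hφ`), the induction
hypothesis at `ϕy`, and injectivity of `σ_y`. DERIVED over typed hypotheses; nothing asserted. [folklore] -/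
theorem eta_teich_mul_eq_of_transports (hφ : ∀ a : F, D.frob (D.teich a) = D.teich (a ^ D.p)) :
    ∀ (k : ℕ) {y : Y}, (∀ i : ℕ, Nonempty (D.FrobeniusTransport (D.frobY^[i] y))) →
      ∀ {ζ : F}, ζ ^ D.p ^ k = 1 → ∀ x : F, D.eta y (D.teich (ζ * x)) = D.eta y (D.teich x) := by
  intro k
  induction k with
  | zero =>
    intro y _ ζ hζ x
    rw [pow_zero, pow_one] at hζ
    rw [hζ, one_mul]
  | succ k ih =>
    intro y hT ζ hζ x
    have hT0 : Nonempty (D.FrobeniusTransport y) := hT 0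
    obtain ⟨T⟩ := hT0
    apply T.residueIso.injective
    rw [T.residueIso_eta, T.residueIso_eta, hφ, hφ, mul_pow]
    have hT' : ∀ i : ℕ, Nonempty (D.FrobeniusTransport (D.frobY^[i] (D.frobY y))) := fun i => by
      rw [← Function.iterate_succ_apply]
      exact hT (i + 1)
    have hζ' : (ζ ^ D.p) ^ D.p ^ k = 1 := by
      rw [← pow_mul, ← pow_succ']
      exact hζ
    exact ih hT' hζ' (x ^ D.p)

/-- **Corollary (what any W6 datum must contain).** At a point whose forward `ϕ`-orbit carries §10.13 transports, under `hφ`, the map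
`Λ_y := η_y ∘ [·] : F → K_y` is `μ_{p^∞}(F)`-invariant, norm-compatible ((A1) `absK_eta_teich`) and onto the unit ball ((A2)
`exists_teich_lift`). Over carriers with `F = K_y = Q̄_p` this is the object §2 supplies; over a characteristic-`p` tilt the invariance
is void. DERIVED; nothing asserted. [folklore] -/
theorem exists_invariant_lift_of_transports (hφ : ∀ a : F, D.frob (D.teich a) = D.teich (a ^ D.p)) {y : Y}
    (hT : ∀ i : ℕ, Nonempty (D.FrobeniusTransport (D.frobY^[i] y))) :
    ∃ Λ : F → K y, (∀ (k : ℕ) (ζ : F), ζ ^ D.p ^ k = 1 → ∀ x : F, Λ (ζ * x) = Λ x) ∧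
      (∀ x : F, D.absK y (Λ x) = D.absF x) ∧ ∀ ξ : K y, D.absK y ξ ≤ 1 → ∃ x : F, Λ x = ξ :=
  ⟨fun x => D.eta y (D.teich x), fun k _ hζ x => D.eta_teich_mul_eq_of_transports hφ k hT hζ x, D.absK_eta_teich y,
    D.exists_teich_lift y⟩

end PeriodRingDatum

/-! ## 2. The torsion quotient of `Q̄_p` and the invariant lift `Λ` -/

namespace Model

variable (p : ℕ) [hp : Fact p.Prime]

/-- The TORSION setoid on `Q̄_p` (a `def`, not an instance): `a ≈ b :⟺ a^k = b^k` for some `k ≠ 0` (off `0`: `b ∈ a·μ_∞`);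
transitivity multiplies the exponents. [folklore] -/
def torsionSetoid : Setoid (PadicAlgCl p) where
  r a b := ∃ k : ℕ, k ≠ 0 ∧ a ^ k = b ^ k
  iseqv :=
    { refl := fun _ => ⟨1, one_ne_zero, rfl⟩
      symm := fun ⟨k, hk, h⟩ => ⟨k, hk, h.symm⟩
      trans := fun ⟨k, hk, h₁⟩ ⟨l, hl, h₂⟩ => ⟨k * l, mul_ne_zero hk hl, by
        rw [pow_mul, h₁, ← pow_mul, mul_comm, pow_mul, h₂, ← pow_mul]⟩ }

/-- The torsion quotient `Q̄_p/≈` (`{0}` and the classes `a·μ_∞`). [folklore] -/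
abbrev TorsionQuot : Type := Quotient (torsionSetoid p)

/-- The class map `a ↦ ⟦a⟧`. [folklore] -/
abbrev tmk (a : PadicAlgCl p) : TorsionQuot p := Quotient.mk (torsionSetoid p) a

/-- `⟦a⟧ = ⟦b⟧ ↔ a^k = b^k` for some `k ≠ 0`. [folklore] -/
theorem tmk_eq_tmk_iff {a b : PadicAlgCl p} : tmk p a = tmk p b ↔ ∃ k : ℕ, k ≠ 0 ∧ a ^ k = b ^ k :=
  ⟨fun h => Quotient.exact h, fun h => Quotient.sound h⟩

/-- `a^k = b^k` with `k ≠ 0` gives equal classes. [folklore] -/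
theorem tmk_eq_of_pow_eq {a b : PadicAlgCl p} {k : ℕ} (hk : k ≠ 0) (h : a ^ k = b ^ k) : tmk p a = tmk p b :=
  Quotient.sound ⟨k, hk, h⟩

/-- The norm is constant on torsion classes. [folklore] -/
theorem norm_eq_of_tmk_eq {a b : PadicAlgCl p} (h : tmk p a = tmk p b) : ‖a‖ = ‖b‖ := by
  obtain ⟨k, hk, h⟩ := (tmk_eq_tmk_iff p).1 h
  have h' := congrArg norm h
  rw [norm_pow, norm_pow] at h'
  exact (pow_left_inj₀ (norm_nonneg a) (norm_nonneg b) hk).1 h'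

/-- The descended norm on the torsion quotient. [folklore] -/
def tnorm : TorsionQuot p → ℝ :=
  Quotient.lift (fun a : PadicAlgCl p => ‖a‖) fun _ _ h => norm_eq_of_tmk_eq p (Quotient.sound h)

/-- `tnorm ⟦a⟧ = ‖a‖`. [folklore] -/
@[simp] theorem tnorm_tmk (a : PadicAlgCl p) : tnorm p (tmk p a) = ‖a‖ := rfl

/-- Every fibre of the class map is COUNTABLE (for each `k`, `x^k = x₀^k` has finitely many solutions). [folklore] -/
theorem countable_fiber (c : TorsionQuot p) : {x : PadicAlgCl p | tmk p x = c}.Countable := by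
  classical
  obtain ⟨x₀, rfl⟩ := Quotient.exists_rep c
  refine (Set.countable_iUnion fun k : ℕ =>
    ((Polynomial.nthRoots (k + 1) (x₀ ^ (k + 1))).toFinset.countable_toSet)).mono ?_
  intro x hx
  obtain ⟨k, hk, h⟩ := (tmk_eq_tmk_iff p).1 hx
  obtain ⟨j, rfl⟩ := Nat.exists_eq_succ_of_ne_zero hk
  exact Set.mem_iUnion.2 ⟨j, by
    rw [Finset.mem_coe, Multiset.mem_toFinset]
    exact (Polynomial.mem_nthRoots j.succ_pos).2 h⟩

/-- `‖p‖ < 1` in `Q̄_p` (= `Literature.NumberTheory.Automorphic.PadicAlgCl.norm_natCast_p_lt_one`, whose heavy module is not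
imported into this supply file; `private` copy). [folklore] -/
private theorem norm_natCast_p_lt_one : ‖(p : PadicAlgCl p)‖ < 1 := by
  rw [← map_natCast (algebraMap ℚ_[p] (PadicAlgCl p)), PadicAlgCl.norm_extends]
  exact Padic.norm_p_lt_one

/-- The unit `u := 1 + p` of `Q̄_p`. [folklore] -/
def unitU : PadicAlgCl p := ((1 + p : ℕ) : PadicAlgCl p)

/-- `‖1 + p‖ = 1` (ultrametric). [folklore] -/
theorem norm_unitU : ‖unitU p‖ = 1 := by
  have hna := PadicAlgCl.isNonarchimedean p
  have hp1 := norm_natCast_p_lt_one p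
  have hu : unitU p = 1 + (p : PadicAlgCl p) := by simp [unitU]
  rw [hu]
  refine le_antisymm ((hna 1 _).trans (max_le (by rw [norm_one]) hp1.le)) ?_
  have h := hna (1 + (p : PadicAlgCl p)) (-(p : PadicAlgCl p))
  rw [add_neg_cancel_right, norm_one, norm_neg] at h
  rcases le_max_iff.1 h with h | h
  · exact h
  · exact absurd h (not_le.2 hp1)

/-- `1 + p` has infinite order: `n ↦ (1+p)^n` is injective (read in `ℕ`). [folklore] -/
theorem unitU_pow_injective : Function.Injective fun n : ℕ => unitU p ^ n := by
  intro m n h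
  have h' : (((1 + p) ^ m : ℕ) : PadicAlgCl p) = (((1 + p) ^ n : ℕ) : PadicAlgCl p) := by
    simpa only [unitU, Nat.cast_pow] using h
  exact Nat.pow_right_injective (by have := hp.out.two_le; omega) (Nat.cast_injective h')

/-- `x·u^m ≈ x·u^n` forces `m = n` (`x ≠ 0`): infinitely many torsion classes on every sphere. [folklore] -/
theorem eq_of_tmk_mul_unitU_pow_eq {x : PadicAlgCl p} (hx : x ≠ 0) {m n : ℕ}
    (h : tmk p (x * unitU p ^ m) = tmk p (x * unitU p ^ n)) : m = n := by
  obtain ⟨k, hk, h⟩ := (tmk_eq_tmk_iff p).1 h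
  rw [mul_pow, mul_pow] at h
  have h' := mul_left_cancel₀ (pow_ne_zero k hx) h
  rw [← pow_mul, ← pow_mul] at h'
  exact Nat.eq_of_mul_eq_mul_right (Nat.pos_of_ne_zero hk) (unitU_pow_injective p h')

/-- The sphere of radius `r` in `Q̄_p`. [folklore] -/
abbrev Sph (r : ℝ) : Type := {x : PadicAlgCl p // ‖x‖ = r}

/-- The sphere of radius `r` in the torsion quotient. [folklore] -/
abbrev TSph (r : ℝ) : Type := {c : TorsionQuot p // tnorm p c = r}

/-- The class map on a sphere. [folklore] -/
def toTSph (r : ℝ) (x : Sph p r) : TSph p r := ⟨tmk p x.1, x.2⟩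

/-- A sphere through `x₀ ≠ 0` has INFINITELY many torsion classes (`x₀·(1+p)^n`). [folklore] -/
theorem infinite_tSph {x₀ : PadicAlgCl p} (hx : x₀ ≠ 0) : Infinite (TSph p ‖x₀‖) := by
  refine Infinite.of_injective
    (fun n : ℕ => (⟨tmk p (x₀ * unitU p ^ n), by simp [norm_unitU]⟩ : TSph p ‖x₀‖)) ?_
  intro m n h
  exact eq_of_tmk_mul_unitU_pow_eq p hx (Subtype.ext_iff.1 h)

/-- **`#S_r ≤ #(S_r/≈)`**: countable fibres, infinite target. [folklore] -/
theorem mk_sph_le (r : ℝ) : #(Sph p r) ≤ #(TSph p r) := by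
  rcases isEmpty_or_nonempty (Sph p r) with h | ⟨⟨x₀, hx₀⟩⟩
  · rw [Cardinal.mk_eq_zero]
    exact zero_le
  rcases eq_or_ne x₀ 0 with h0 | h0
  · refine Cardinal.mk_le_of_injective (f := toTSph p r) ?_
    rintro ⟨x, hx⟩ ⟨y, hy⟩ _
    have hr : r = 0 := by rw [← hx₀, h0, norm_zero]
    apply Subtype.ext
    show x = y
    rw [hr, norm_eq_zero] at hx hy
    rw [hx, hy]
  · have hinf : ℵ₀ ≤ #(TSph p r) := Cardinal.infinite_iff.1 (hx₀ ▸ infinite_tSph p h0)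
    calc #(Sph p r) ≤ #(TSph p r) * ℵ₀ :=
          Cardinal.mk_le_mk_mul_of_mk_preimage_le (toTSph p r) fun c => ?_
      _ = #(TSph p r) := Cardinal.mul_aleph0_eq hinf
    rw [Cardinal.le_aleph0_iff_set_countable]
    have hpre : toTSph p r ⁻¹' {c} = Subtype.val ⁻¹' {x : PadicAlgCl p | tmk p x = c.1} := by
      ext x
      simp only [Set.mem_preimage, Set.mem_singleton_iff, Set.mem_setOf_eq, toTSph, Subtype.ext_iff]
    rw [hpre]
    exact (countable_fiber p c.1).preimage_of_injOn Subtype.val_injective.injOn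

/-- A norm-preserving INJECTION of each sphere into the sphere of classes (from `mk_sph_le`). [folklore] -/
def sphEmb (r : ℝ) : Sph p r ↪ TSph p r := Classical.choice ((Cardinal.le_def _ _).1 (mk_sph_le p r))

/-- Glued: a norm-preserving injection `Q̄_p ↪ TorsionQuot`. [folklore] -/
def normEmb (x : PadicAlgCl p) : TorsionQuot p := (sphEmb p ‖x‖ ⟨x, rfl⟩).1

/-- `normEmb` preserves the norm. [folklore] -/
theorem tnorm_normEmb (x : PadicAlgCl p) : tnorm p (normEmb p x) = ‖x‖ := (sphEmb p ‖x‖ ⟨x, rfl⟩).2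

/-- `normEmb` is injective. [folklore] -/
theorem normEmb_injective : Function.Injective (normEmb p) := by
  intro x y h
  have hn : ‖x‖ = ‖y‖ := by rw [← tnorm_normEmb p x, h, tnorm_normEmb]
  suffices key : ∀ (r r' : ℝ), r = r' → ∀ (s : Sph p r) (t : Sph p r'),
      (sphEmb p r s).1 = (sphEmb p r' t).1 → s.1 = t.1 from key ‖x‖ ‖y‖ hn ⟨x, rfl⟩ ⟨y, rfl⟩ h
  rintro r _ rfl s t hst
  exact congrArg Subtype.val ((sphEmb p r).injective (Subtype.ext hst))

open scoped Classical in
/-- The lift on CLASSES: invert `normEmb` on its image, take a representative elsewhere. [folklore] -/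
def invLiftT (c : TorsionQuot p) : PadicAlgCl p := if h : ∃ x, normEmb p x = c then h.choose else c.out

/-- `invLiftT` is norm-preserving. [folklore] -/
theorem norm_invLiftT (c : TorsionQuot p) : ‖invLiftT p c‖ = tnorm p c := by
  unfold invLiftT
  split_ifs with h
  · rw [← tnorm_normEmb p h.choose, h.choose_spec]
  · conv_rhs => rw [← Quotient.out_eq c]
    rfl

/-- **`Λ := invLiftT ∘ ⟦·⟧ : Q̄_p → Q̄_p`** — the torsion-invariant lift. [folklore] -/
def invLift (x : PadicAlgCl p) : PadicAlgCl p := invLiftT p (tmk p x)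

/-- `Λ` is norm-preserving: `‖Λ x‖ = ‖x‖`. [folklore] -/
theorem norm_invLift (x : PadicAlgCl p) : ‖invLift p x‖ = ‖x‖ := norm_invLiftT p _

/-- `Λ` is TORSION-INVARIANT: `a^k = b^k` with `k ≠ 0` ⟹ `Λ a = Λ b`. [folklore] -/
theorem invLift_eq_of_pow_eq {a b : PadicAlgCl p} {k : ℕ} (hk : k ≠ 0) (h : a ^ k = b ^ k) :
    invLift p a = invLift p b :=
  congrArg (invLiftT p) (tmk_eq_of_pow_eq p hk h)

/-- In particular `Λ (ζ·a) = Λ a` for every root of unity `ζ`. [folklore] -/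
theorem invLift_mul_eq_of_pow_eq_one {ζ a : PadicAlgCl p} {k : ℕ} (hk : k ≠ 0) (hζ : ζ ^ k = 1) :
    invLift p (ζ * a) = invLift p a :=
  invLift_eq_of_pow_eq p hk (by rw [mul_pow, hζ, one_mul])

/-- The `μ_{p^∞}` form used by the W6 datum: `a^{p^k} = b^{p^k}` ⟹ `Λ a = Λ b`. [folklore] -/
theorem invLift_eq_of_pow_prime_pow_eq {a b : PadicAlgCl p} {k : ℕ} (h : a ^ p ^ k = b ^ p ^ k) :
    invLift p a = invLift p b :=
  invLift_eq_of_pow_eq p (pow_ne_zero k hp.out.ne_zero) h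

/-- `Λ` is SURJECTIVE (`ξ = Λ (out (normEmb ξ))`). [folklore] -/
theorem invLift_surjective : Function.Surjective (invLift p) := by
  intro ξ
  refine ⟨(normEmb p ξ).out, ?_⟩
  have hex : ∃ x, normEmb p x = normEmb p ξ := ⟨ξ, rfl⟩
  show invLiftT p (tmk p (normEmb p ξ).out) = ξ
  have hout : tmk p (normEmb p ξ).out = normEmb p ξ := Quotient.out_eq _
  rw [hout]
  unfold invLiftT
  rw [dif_pos hex]
  exact normEmb_injective p hex.choose_spec

/-- **Packaged supply**: a map `Λ : Q̄_p → Q̄_p` that is invariant under the torsion relation (all roots of unity), norm-preserving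
and onto. [folklore] -/
theorem exists_invariantLift :
    ∃ Λ : PadicAlgCl p → PadicAlgCl p, (∀ (k : ℕ), k ≠ 0 → ∀ a b : PadicAlgCl p, a ^ k = b ^ k → Λ a = Λ b) ∧
      (∀ x, ‖Λ x‖ = ‖x‖) ∧ Function.Surjective Λ :=
  ⟨invLift p, fun _ hk _ _ h => invLift_eq_of_pow_eq p hk h, norm_invLift p, invLift_surjective p⟩

end Model

end Summit.ABC.IUTFork.Joshi

end
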